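import Mathlib.LinearAlgebra.Matrix.Permanent
import Mathlib.Algebra.MvPolynomial.Funext
import Mathlib.Algebra.Order.BigOperators.Group.Finset
import Literature.Computability.AlgebraicComplexity.StandardFamilies

/-!
# Route LiftNullstellensatz — `LiftWidthPerFour` (item stmt-ValiantsHypothesis-5922): linear spaces
on the permanental hypersurface, step F2 (Meshulam / Guterman–Meshulam–Spiridonov)

Towards CLAIM F (every linear subspace of `M_4(ℂ)` of dimension `≥ 11` on which `per_4`
vanishes lies in `{row i = 0}` or `{col j = 0}`), following A. Guterman, R. Meshulam,
I. Spiridonov, *Maximal generalized rank in graphical matrix spaces*, Israel J. Math. (2023),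
arXiv:2212.11193, Prop. 2.2: if a linear space of matrices contains, for every row `r`, a matrix
`A_r` in "echelon position" `(r, c r)` (zero above row `r`, zero left of column `c r` in row `r`,
entry `1` at `(r, c r)`) with `c` a transversal, then some linear combination `Σ θ_r A_r` has
nonzero permanent (`exists_permanent_ne_zero_of_echelon`).  Proof: the coefficient of
`θ_1 ⋯ θ_n` in `per(Σ θ_r A_r)` is `1`.  Over an infinite field a nonzero polynomial has a
non-root.  No new definitions.
-/

noncomputable section

open MvPolynomial Matrix Finset

namespace Summit.ValiantsHypothesis.LiftNullstellensatz

/-- The permanent commutes with ring homomorphisms. [folklore] -/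
theorem permanent_map_ringHom {n : Type*} [Fintype n] [DecidableEq n] {R S : Type*} [CommRing R]
    [CommRing S] (f : R →+* S) (M : Matrix n n R) : (M.map f).permanent = f M.permanent := by
  simp only [Matrix.permanent, map_sum, map_prod, Matrix.map_apply]

/-- A function `x : Fin n → Fin n` whose "value multiset" `Σ_i δ_{x i}` is `Σ_t δ_t` is a
bijection. [folklore] -/
theorem bijective_of_sum_single_eq {n : ℕ} (x : Fin n → Fin n)
    (h : (∑ i, Finsupp.single (x i) (1 : ℕ)) = ∑ t, Finsupp.single t 1) : Function.Bijective x := by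
  classical
  have hinj : Function.Injective x := by
    intro i j hij
    by_contra hne
    have h1 : (∑ t : Fin n, Finsupp.single t (1 : ℕ)) (x i) = 1 := by
      rw [Finset.sum_apply']
      simp [Finsupp.single_apply]
    have h2 : 2 ≤ (∑ k : Fin n, Finsupp.single (x k) (1 : ℕ)) (x i) := by
      rw [Finset.sum_apply']
      calc 2 = ∑ k ∈ ({i, j} : Finset (Fin n)), Finsupp.single (x k) (1 : ℕ) (x i) := by
              rw [Finset.sum_pair hne]; simp [hij]
        _ ≤ ∑ k, Finsupp.single (x k) (1 : ℕ) (x i) :=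
              Finset.sum_le_sum_of_subset_of_nonneg (Finset.subset_univ _) (fun _ _ _ => Nat.zero_le _)
    rw [h] at h2
    omega
  exact ⟨hinj, Finite.injective_iff_surjective.1 hinj⟩

/-- **Transversal of echelon positions ⇒ nonzero permanent in the span** (Meshulam; Guterman–
Meshulam–Spiridonov, Prop. 2.2, square case, over an infinite field): if `A_r` (`r < n`) vanishes
on the rows above `r`, vanishes on row `r` left of column `c r`, has entry `1` at `(r, c r)`, and
`c` is injective, then `per(Σ_r θ_r A_r) ≠ 0` for some `θ`. [cite: GutermanMeshulamSpiridonov2023, Prop. 2.2] -/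
theorem exists_permanent_ne_zero_of_echelon {K : Type*} [Field K] [Infinite K] {n : ℕ}
    (A : Fin n → Matrix (Fin n) (Fin n) K) (c : Fin n → Fin n) (hc : Function.Injective c)
    (hrow : ∀ t r, r < t → ∀ j, A t r j = 0) (hcol : ∀ t j, j < c t → A t t j = 0)
    (hone : ∀ t, A t t (c t) = 1) :
    ∃ θ : Fin n → K, (∑ t, θ t • A t).permanent ≠ 0 := by
  classical
  -- the permanent of `Σ_t X_t A_t` as a polynomial in the `X_t`
  set M : Matrix (Fin n) (Fin n) (MvPolynomial (Fin n) K) :=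
    Matrix.of fun i j => ∑ t, X t * C (A t i j) with hM
  set P : MvPolynomial (Fin n) K := M.permanent with hP
  -- evaluation
  have heval : ∀ θ : Fin n → K, eval θ P = (∑ t, θ t • A t).permanent := by
    intro θ
    rw [hP, ← permanent_map_ringHom (eval θ)]
    congr 1
    ext i j
    simp only [Matrix.map_apply, hM, Matrix.of_apply, map_sum, map_mul, eval_X, eval_C,
      Matrix.sum_apply, Matrix.smul_apply, smul_eq_mul]
  -- the coefficient of `X_1 ⋯ X_n` is `1`
  set m : Fin n →₀ ℕ := ∑ t, Finsupp.single t 1 with hm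
  have hmono : ∀ x : Fin n → Fin n, (∏ i, (X (x i) : MvPolynomial (Fin n) K)) =
      monomial (∑ i, Finsupp.single (x i) 1) 1 := by
    intro x
    rw [monomial_sum_one]
    rfl
  -- expansion of the permanent of `M`
  have hexp : P = ∑ σ : Equiv.Perm (Fin n), ∑ x : Fin n → Fin n,
      monomial (∑ i, Finsupp.single (x i) 1) (∏ i, A (x i) (σ i) i) := by
    rw [hP, Matrix.permanent]
    refine Finset.sum_congr rfl fun σ _ => ?_
    have : (∏ i, M (σ i) i) = ∏ i, ∑ t, (X t * C (A t (σ i) i) : MvPolynomial (Fin n) K) := by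
      simp only [hM, Matrix.of_apply]
    rw [this, Finset.prod_univ_sum]
    simp only [Fintype.piFinset_univ]
    refine Finset.sum_congr rfl fun x _ => ?_
    rw [Finset.prod_mul_distrib, hmono, ← map_prod, mul_comm, C_mul_monomial, mul_one]
  have hcoeff : coeff m P = 1 := by
    rw [hexp, coeff_sum]
    simp only [coeff_sum, coeff_monomial]
    -- only bijective `x`, and then only `x = σ`, contribute
    have inner : ∀ σ : Equiv.Perm (Fin n),
        (∑ x : Fin n → Fin n, if (∑ i, Finsupp.single (x i) 1) = m then ∏ i, A (x i) (σ i) i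
          else 0) = ∏ i, A (σ i) (σ i) i := by
      intro σ
      rw [Finset.sum_eq_single (σ : Fin n → Fin n)]
      · rw [if_pos]
        rw [hm]
        exact Equiv.sum_comp σ (fun t => Finsupp.single t (1 : ℕ))
      · intro x _ hx
        split_ifs with hxm
        · -- `x` bijective, `x ≠ σ`: some column `i` has `σ i < x i`, and there `A (x i)` vanishes
          have hxb : Function.Bijective x := bijective_of_sum_single_eq x (by rw [hxm, hm])
          by_cases hle : ∀ i, (x i : ℕ) ≤ σ i
          · exfalso
            apply hx
            have e1 : (∑ i, (x i : ℕ)) = ∑ i : Fin n, (i : ℕ) :=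
              Equiv.sum_comp (Equiv.ofBijective x hxb) (fun t : Fin n => (t : ℕ))
            have e2 : (∑ i, (σ i : ℕ)) = ∑ i : Fin n, (i : ℕ) :=
              Equiv.sum_comp σ (fun t : Fin n => (t : ℕ))
            have hsum : (∑ i, (x i : ℕ)) = ∑ i, (σ i : ℕ) := by rw [e1, e2]
            have heq := (Finset.sum_eq_sum_iff_of_le (fun i _ => hle i)).1 hsum
            funext i
            exact Fin.ext (heq i (Finset.mem_univ i))
          · push Not at hle
            obtain ⟨i, hi⟩ := hle
            exact Finset.prod_eq_zero (Finset.mem_univ i) (hrow _ _ (by exact_mod_cast hi) _)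
        · rfl
      · intro h; exact absurd (Finset.mem_univ _) h
    simp only [inner]
    -- now `Σ_σ ∏_i A (σ i) (σ i) i = 1`: only `σ⁻¹ = c` contributes
    have hcb : Function.Bijective c := ⟨hc, Finite.injective_iff_surjective.1 hc⟩
    set γ : Equiv.Perm (Fin n) := (Equiv.ofBijective c hcb).symm with hγ
    have hγc : ∀ r, γ.symm r = c r := fun r => rfl
    have hγc' : ∀ r, γ (c r) = r := fun r => (Equiv.ofBijective c hcb).symm_apply_apply r
    rw [Finset.sum_eq_single γ]
    · -- `∏_i A (γ i) (γ i) i = ∏_r A r r (c r) = 1`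
      rw [← Equiv.prod_comp γ.symm (fun i => A (γ i) (γ i) i)]
      simp only [hγc, hγc', hone, Finset.prod_const_one]
    · intro σ _ hσ
      -- reindex by rows: `∏_i A (σ i) (σ i) i = ∏_r A r r (σ⁻¹ r)`
      rw [← Equiv.prod_comp σ.symm (fun i => A (σ i) (σ i) i)]
      simp only [Equiv.apply_symm_apply]
      by_cases hle : ∀ r, (c r : ℕ) ≤ σ.symm r
      · exfalso
        apply hσ
        have e1 : (∑ r, (c r : ℕ)) = ∑ i : Fin n, (i : ℕ) :=
          Equiv.sum_comp (Equiv.ofBijective c hcb) (fun t : Fin n => (t : ℕ))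
        have e2 : (∑ r, (σ.symm r : ℕ)) = ∑ i : Fin n, (i : ℕ) :=
          Equiv.sum_comp σ.symm (fun t : Fin n => (t : ℕ))
        have hsum : (∑ r, (c r : ℕ)) = ∑ r, (σ.symm r : ℕ) := by rw [e1, e2]
        have heq := (Finset.sum_eq_sum_iff_of_le (fun r _ => hle r)).1 hsum
        have : σ.symm = γ.symm := by
          ext r
          rw [hγc]
          exact congrArg Fin.val (Fin.ext (heq r (Finset.mem_univ r))).symm ▸ rfl
        simpa using congrArg Equiv.symm this
      · push Not at hle
        obtain ⟨r, hr⟩ := hle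
        exact Finset.prod_eq_zero (Finset.mem_univ r) (hcol _ _ (by exact_mod_cast hr))
    · intro h; exact absurd (Finset.mem_univ _) h
  -- conclude: `P ≠ 0`, so some evaluation is nonzero
  by_contra hall
  push Not at hall
  have hP0 : P = 0 := MvPolynomial.funext fun θ => by rw [heval, hall θ, map_zero]
  have := hcoeff
  rw [hP0, coeff_zero] at this
  exact zero_ne_one this

end Summit.ValiantsHypothesis.LiftNullstellensatz

end
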